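import Mathlib.Analysis.SpecialFunctions.Exponential
import Mathlib.Analysis.SpecialFunctions.Pow.Real
import Mathlib.Algebra.Order.BigOperators.Group.Finset
import HarnessLib

/-!
# Dimock, *Ultraviolet stability for QED in d = 3*, §4.2.2 «boson integral — large field region», LEMMA 23 (471)
# «`ζ⁰_{k+1}(P_{k+1}) ≤ exp(−p_{k+1}(Mr_{k+1})⁻³|P^{(k+1)}_{k+1}| + CM²p⁻¹_{k+1}‖dA_k‖²_{(Λ_k−Ω_{k+1})^{2♮}})`» and its
# three companions for `ζ′_k(Q_{k+1})`, `ζ†_k(R_{k+1})`, `ζ̂_k(U_{k+1})` — the bounds on the LARGE-FIELD CHARACTERISTIC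
# FUNCTIONS by which §4.2.2 «extract[s] the small factors enabling the convergence of the whole expansion»: the printed
# proof's per-cube step (479)∕(484)∕(485)∕(486), the product over the cubes, the overlap count (480) and the enforcing
# step after (478) PROVED in abstract finite form

statement-level skeleton of published theorems with citation tags; proofs where landed; nothing here is a claim about the Yang–Mills mass gap

**Citation header (reproduction of PUBLISHED work).** J. Dimock, *Ultraviolet stability for QED in d = 3*, Ann. Henri
Poincaré **23** (2022) 2113–2205 (= arXiv:2009.01156v2) [Dimock2022UVStabilityQED3], §4.2.2 LEMMA 23 (471) p.64 L8–48
with its proof p.64 L49 – p.66 L33: the regularity preliminaries (472)–(478) p.64 L49 – p.65 L5, the enforcing paragraph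
p.65 L6–16, the per-cube bound (479) p.65 L16–30, the product and the count of cubes p.65 L31–36, the overlap count
(480) p.65 L37–55, the region inclusions p.65 L56–72, the `ζ′` case (481)–(484) p.65 L73–115, the `ζ†` case (485) p.65
L116 – p.66 L22, the `ζ̂` case (486) p.66 L23–33; read in the held arXiv text layer `paper:arxiv-2009.01156` (`p.NN Lnn` =
PDF page ∕ text-layer line).  Writer seat p11 (literature-prover-lit-balaban-p11-g26-0), YM LIT SWEEP item (c) D8 (row
C08; zero weight for the YM-INPRINT tokens — LEMMA 23 feeds (489)–(492) and LEMMA 24, cf. `QED3LargeFieldPartitionBound`;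
the assembler's record of 2026-08-23T14:00Z lists «Lemma 23» as a remaining input of the D8 §4.2 chain).  Sibling of
this directory's `SmallFactors` ([Dimock2013BalabanIII] §3.3 LEMMAS 11–12: the OPPOSITE-sign extraction
`exp(−c‖f‖²_P)·ζ(P) ≤ exp(−cp²·#cubes)`); here the field term is BORROWED with a positive sign, to be repaid by the
Gaussian measure in LEMMA 24.  Mathlib only.

**The printed text (verbatim, text layer).**  p.64 L5–48: *"We start with estimates on the large field characteristic
functions. The following result refers to the characterstic functions as they were when created after k streps, and
before relabling and scaling in the next K − k step. Lemma 23. On `T^{−k}_{N−k}` with axial `A_k` on `T⁰_{N−k}` and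
`A_{k+1} = QA_k`  `ζ⁰_{k+1}(P_{k+1}) ≤ exp(−p_{k+1}(Mr_{k+1})⁻³|P^{(k+1)}_{k+1}| + CM²p⁻¹_{k+1}‖dA_k‖²_{(Λ_k−Ω_{k+1})^{2♮}})`
`ζ′_k(Q_{k+1}) ≤ exp(−p²_{0,k}(Mr_{k+1})⁻³|Q^{(k+1)}_{k+1}| + CM²p⁻²_{0,k}‖dA_k‖²_{(Λ_k−Ω_{k+1})^{2♮}})`  `ζ†_k(R_{k+1}) ≤
exp(−p^{4∕3}_{0,k}(Mr_{k+1})⁻³|R^{(k+1)}_{k+1}| + Cp^{−4∕3}_{0,k}‖Z_k‖²_{(Ω_{k+1}−Λ_{k+1})^♮})`  `ζ̂_k(U_{k+1}) ≤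
exp(−p_{0,k}(Mr_{k+1})⁻³|U^{(k+1)}_{k+1}| + Cp⁻¹_{0,k}‖Z_k‖²_{Ω_{k+1}−Λ_{k+1}})` (471)"*.  p.65 L1–5: *"… Thus we have on `□̃`
`|dA⁰_{k+1,Ω⁺(□)}| ≤ CM‖dA_k‖_{∞,□∼3}` (478)"*.  p.65 L6–30: *"Having established this preliminary bound we now argue as
follows. The `ζ⁰_{k+1}(□)` enforces that there must be a bond in `□∼3` where `|dA_k| ≥ (CM)⁻¹L^{−3∕2}p_k` since otherwise (478)
says `|dA⁰_{k+1,Ω⁺(□)}| ≤ L^{−3∕2}p_{k+1}` everywhere in `□̃` which contradicts the definition of `ζ⁰_{k+1}(□)`. Absorb the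
`L^{−3∕2}` in the `C⁻¹` so `ζ⁰_{k+1}(□)` enforces there is at least one bond in `□∼3` so that `|dA_k| ≥ (CM)⁻¹p_{k+1}`. Now we
claim that for the unit lattice field `A_k`  `ζ⁰_{k+1}(□) ≤ exp(−p_{k+1} + (CM)²p⁻¹_{k+1}‖dA_k‖²_{□∼3})` (479) Indeed if
`ζ⁰_{k+1}(□) = 0` the inequality is trivial, while if `ζ⁰_{k+1}(□) = 1` then `‖dA_k‖²_{□∼3} ≥ ((CM)⁻¹p_{k+1})²` and the
inequality holds."*  p.65 L31–72: *"Now take the product over `□ ⊂ P_{k+1}` to get a bound on `ζ⁰_{k+1}(P_{k+1})`. The volume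
of `P_{k+1}` is `|P^{(k)}_{k+1}| = L³|P^{(k+1)}_{k+1}|`. Each cube has volume `(LMr_{k+1})³` so the number of cubes in `P_{k+1}` is
`(Mr_{k+1})⁻³|P^{(k+1)}_{k+1}|`. We also use `Σ_{□⊂P_{k+1}}‖dA_k‖²_{□∼3} = Σ_{□⊂P_{k+1}}Σ_{□′⊂□∼3}‖dA_k‖²_{□′} = O(1)Σ_{□′⊂P∼3_{k+1}}
‖dA_k‖²_{□′} = O(1)‖dA_k‖²_{P∼3_{k+1}}` (480) But … Thus `P∼3_{k+1} ⊂ Λ^{2♮}_k ∩ [Ω^c_{k+1}]^{2♮} = [Λ_k − Ω_{k+1}]^{2♮}` …, which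
we use in (480). Altogether the announced bound on `ζ⁰_{k+1}(P_{k+1})` results."*  p.65 L98–115: *"Now `ζ′_k(□)` enforces
that there must be a bond in `□∼3` such that `|dA_k| ≥ (CM)⁻¹p²_{0,k}` … Therefore `|ζ′_k(□)| ≤ exp(−p²_{0,k} +
(CM)²p⁻²_{0,k}‖dA_k‖²_{□∼3})` (484) Take the product over `□ ⊂ Q_{k+1}` to get the result as before."*  p.66 L1–22: *"…
This implies that there must be a point in `□̃` where `|Z̃_k| ≥ C⁻¹p^{4∕3}_{0,k}`. Thus `ζ†(□) ≤ exp(−p^{4∕3}_{0,k} +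
C²p^{−4∕3}_{0,k}‖Z̃_k‖²_{□̃})` (485) Take the product over `□ ⊂ R_{k+1}`. … which gives the result."*  p.66 L23–33: *"For
`□ ⊂ U_{k+1}` the characteristic function `ζ̂(□)` enforces there is at least one point in `□` where `|Z̃_k| ≥ p_{0,k}`. and
so `ζ̂(□) ≤ exp(−p_{0,k} + p⁻¹_{0,k}‖Z_k‖²_□)` (486) Again take the product over `□ ⊂ U_{k+1}`. Since `U_k ⊂ Ω_{k+1} −
Λ_{k+1}` we have. the result. This completes the proof."*

**What is formalized (kernel-checked, zero `sorry`, no named facts; theorems only).**  ABSTRACT FINITE FORM: bonds ∕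
points form any type `α`, cubes any type `β`; a large-field region is a finite family `cs : Finset β` of cubes, each
with its search set `S(□) : Finset α` (the print's `□∼3`, `□̃`, or `□` itself); the field is any `f : α → ℝ` (the
print's `dA_k` on bonds, `Z̃_k`∕`Z_k` on points); a characteristic function is any `ζ : β → ℝ` with `0 ≤ ζ(□) ≤ 1` that
ENFORCES a large value: `ζ(□) ≠ 0 → ∃ b ∈ S(□), q ≤ |f b|`.
* §1 **`exists_large_of_regularity`** — the enforcing paragraph p.65 L6–13 as the contrapositive of a regularity bound
  of the shape (478): if `|g x| ≤ c·sup_{S}|f|` on `□̃` and some `x ∈ □̃` has `|g x| ≥ t`, then some `b ∈ S` has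
  `|f b| ≥ t∕c`.
* §2 **`zeta_le_exp`** — the per-cube step in its common form: `ζ(□) ≤ exp(−a + (a∕q²)‖f‖²_{S(□)})` for a rate `a ≥ 0`
  and a threshold `q > 0` (*"if ζ(□) = 0 the inequality is trivial, while if ζ(□) = 1 then ‖f‖²_S ≥ q² and the
  inequality holds"*); the four printed instances **`eq479`** (`a = p_{k+1}`, `q = (CM)⁻¹p_{k+1}`, coefficient
  `(CM)²p⁻¹_{k+1}`), **`eq484`** (`a = p²_{0,k}`, `q = (CM)⁻¹p²_{0,k}`, `(CM)²p⁻²_{0,k}`), **`eq485`** (`a = p^{4∕3}_{0,k}`,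
  `q = C⁻¹p^{4∕3}_{0,k}`, `C²p^{−4∕3}_{0,k}`), **`eq486`** (`a = q = p_{0,k}`, `p⁻¹_{0,k}`).
* §3 **`prod_zeta_le_exp`** — *"take the product over □"*: `Π_□ζ(□) ≤ exp(−a·#cubes + (a∕q²)Σ_□‖f‖²_{S(□)})`.
* §4 **`sum_sum_le_mul_sum_of_overlap`**, **`eq480`** — (480): if every bond of `X` lies in at most `m` of the search
  sets `S(□) ⊆ X` then `Σ_□‖f‖²_{S(□)} ≤ m‖f‖²_X` (the print's `O(1)`, `X = P∼3_{k+1} ⊂ [Λ_k − Ω_{k+1}]^{2♮}`);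
  `card_filter_mem_le_one` (disjoint cubes: `m = 1`), `card_cubes_mul_vol` ∕ **`card_cubes_eq`** (*"the number of cubes
  in P_{k+1} is (Mr_{k+1})⁻³|P^{(k+1)}_{k+1}|"*: `#cubes = V⁻¹·|⋃_□S(□)|` for disjoint cubes of `V` sites).
* §5 **`lemma23_shape`** — LEMMA 23's common shape `Π_□ζ(□) ≤ exp(−a·#cubes + (a∕q²)·m·‖f‖²_X)`, and the four lines of
  (471) with the printed rates and coefficients: **`zeta0_bound`** (`exp(−p_{k+1}n + (CM)²m·p⁻¹_{k+1}‖dA_k‖²_X)`),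
  **`zetaPrime_bound`** (`exp(−p²_{0,k}n + (CM)²m·p⁻²_{0,k}‖dA_k‖²_X)`), **`zetaDagger_bound`** (`exp(−p^{4∕3}_{0,k}n +
  C²m·p^{−4∕3}_{0,k}‖Z_k‖²_X)`), **`zetaHat_bound`** (disjoint cubes searched in themselves: `exp(−p_{0,k}n + p⁻¹_{0,k}‖Z_k‖²_X)`),
  `n = #cubes`.
* §6 **`decay_min_coefficient`**, **`eq489_level`** — the step after (490), *"In the decay factors take the minimum
  coefficient which is `p_{0,j}`"*: with `1 ≤ p_{0,j} ≤ p_{j+1}` the product of the four level-`j` bounds is at most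
  `exp(−p_{0,j}(n_P + n_Q + n_R + n_U) + Σ field terms)` (the shift `j → j−1` and `p_{0,j} ≥ 2p_{0,j+1}` of (491) are index
  bookkeeping on the printed parameters, not re-derived).
* §7 two numerical instances.

**Readings (declared).**  (i) The characteristic functions `ζ⁰_{k+1}`, `ζ′_k`, `ζ†_k`, `ζ̂_k` ((50), (54) and §2 of the
paper) are not constructed; what the proof uses of them — values in `[0,1]` (they are `{0,1}`-valued) and the
ENFORCING property established on p.65 L6–16, L98–104, p.66 L1–6, L23–25 — is the hypothesis `henf`; §1 shows how a
regularity bound of the shape (478)∕(483) produces it.  (ii) The regularity inputs (472)–(478) (Theorem 1 of [31]),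
(481)–(483) (lemma 16 of [31]) and the local bound on `C^{½,loc}_{k,Ω⁺}` (p.65 L116 – p.66 L2) are NOT formalized.  (iii)
The region inclusions `P∼3_{k+1} ⊂ [Λ_k − Ω_{k+1}]^{2♮}`, `R̃_{k+1} ⊂ [Ω_{k+1} − Λ_{k+1}]^♮`, `U_k ⊂ Ω_{k+1} − Λ_{k+1}` (p.65
L56–72, p.66 L19–22, L32) enter as `S(□) ⊆ X`; the print's `O(1)` of (480) is the explicit overlap multiplicity `m`
(for `□∼3` on a cubic lattice `m = 7³`), so the printed constants `CM²p⁻¹_{k+1}` etc. of (471) are `(CM)²m·p⁻¹_{k+1}` etc.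
here (the print's generic `C` absorbs `C²m`).  (iv) `(Mr_{k+1})⁻³|P^{(k+1)}_{k+1}|` is the number `n` of cubes
(`card_cubes_eq` with `V = (Mr_{k+1})³` in `L`-cube units); the scalings (489)–(490) are relabellings in the abstract form.
(v) p.66 L126 – p.67 L1: *"In the decay factors take the minimum coefficient which is `p_{0,j} ≥ 2p_{0,j+1}` and shift
`j → j − 1`. Then"* (491) — §6 proves the minimum under `1 ≤ p_{0,j} ≤ p_{j+1}` (the standing choice of the parameters,
§2.2 of the paper); the comparison `p_{0,j} ≥ 2p_{0,j+1}` is taken as printed and not used.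

**Honest scope.**  Elementary real-number and finite-sum bookkeeping of the printed proof; no gauge field, no
averaging operator, no torus geometry is constructed; nothing of LEMMA 23's hypotheses «axial `A_k`, `A_{k+1} = QA_k`» is
used or claimed.  No `d = 4` statement; nothing about Bałaban's papers.
-/

noncomputable section

open Finset

namespace Literature.MathematicalPhysics.QuantumFieldTheory.Dimock2011to13

namespace QED3LargeFieldCharacteristic

/-! ## §1 After (478): «ζ enforces a large bond of the unit-lattice field» — the contrapositive of a regularity bound -/

section Enforce

variable {α γ : Type*}

/-- **The enforcing step** (p.65 L6–16, and again L98–104, p.66 L1–6): if a derived field `g` is dominated on `□̃ = D` by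
the unit-lattice field `f` on the search set `S` — `|g x| ≤ c·sup_{b∈S}|f b|`, the shape of (478) «`|dA⁰_{k+1,Ω⁺(□)}| ≤
CM‖dA_k‖_{∞,□∼3}`» and of (483) — and the characteristic function has found a point `x ∈ □̃` with `|g x| ≥ t`, then *"there
must be a bond in `□∼3` where"* `|f b| ≥ t∕c` (*"since otherwise (478) says `|dA⁰_{k+1,Ω⁺(□)}| ≤ L^{−3∕2}p_{k+1}` everywhere in
`□̃` which contradicts the definition of `ζ⁰_{k+1}(□)`"*).
[cite: Dimock2022UVStabilityQED3, §4.2.2 Lemma 23 proof p.65 L1–16 ((478) and the enforcing paragraph); L98–104; p.66 L1–6] -/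
theorem exists_large_of_regularity (S : Finset α) (hS : S.Nonempty) (f : α → ℝ) (D : Finset γ) (g : γ → ℝ)
    {c t : ℝ} (hc : 0 < c) (hreg : ∀ x ∈ D, |g x| ≤ c * S.sup' hS (fun b => |f b|))
    (hlarge : ∃ x ∈ D, t ≤ |g x|) : ∃ b ∈ S, t / c ≤ |f b| := by
  obtain ⟨x, hx, htx⟩ := hlarge
  obtain ⟨b, hb, hsup⟩ := Finset.exists_mem_eq_sup' hS (fun b => |f b|)
  refine ⟨b, hb, ?_⟩
  rw [div_le_iff₀ hc, ← hsup, mul_comm]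
  exact htx.trans (hreg x hx)

end Enforce

/-! ## §2 (479), (484), (485), (486): the bound for one cube -/

section Cube

variable {α : Type*}

/-- **The per-cube step, common form of (479)∕(484)∕(485)∕(486)**: a characteristic function `ζ ≤ 1` which ENFORCES
*"at least one bond in"* `S` *"so that"* `|f| ≥ q` (`q > 0`) satisfies, for every rate `a ≥ 0`,
`ζ ≤ exp(−a + (a∕q²)·Σ_{b∈S}f(b)²)` — *"Indeed if `ζ(□) = 0` the inequality is trivial, while if `ζ(□) = 1` then
`‖f‖²_S ≥ q²` and the inequality holds."*
[cite: Dimock2022UVStabilityQED3, §4.2.2 Lemma 23 proof (479) p.65 L16–30] -/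
theorem zeta_le_exp (S : Finset α) (f : α → ℝ) {ζ a q : ℝ} (hζ1 : ζ ≤ 1) (ha : 0 ≤ a) (hq : 0 < q)
    (henf : ζ ≠ 0 → ∃ b ∈ S, q ≤ |f b|) :
    ζ ≤ Real.exp (-a + a / q ^ 2 * ∑ b ∈ S, f b ^ 2) := by
  by_cases hz : ζ = 0
  · rw [hz]; exact (Real.exp_pos _).le
  · obtain ⟨b, hb, hqb⟩ := henf hz
    refine hζ1.trans (Real.one_le_exp ?_)
    have h1 : q ^ 2 ≤ f b ^ 2 := by
      calc q ^ 2 ≤ |f b| ^ 2 := pow_le_pow_left₀ hq.le hqb 2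
        _ = f b ^ 2 := sq_abs _
    have h2 : f b ^ 2 ≤ ∑ b ∈ S, f b ^ 2 := Finset.single_le_sum (fun x _ => sq_nonneg (f x)) hb
    have h3 : a ≤ a / q ^ 2 * ∑ b ∈ S, f b ^ 2 :=
      calc a = a / q ^ 2 * q ^ 2 := by field_simp
        _ ≤ a / q ^ 2 * ∑ b ∈ S, f b ^ 2 := mul_le_mul_of_nonneg_left (h1.trans h2) (by positivity)
    linarith

/-- **(479)**: *"`ζ⁰_{k+1}(□)` enforces there is at least one bond in `□∼3` so that `|dA_k| ≥ (CM)⁻¹p_{k+1}`. Now we claim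
that for the unit lattice field `A_k`  `ζ⁰_{k+1}(□) ≤ exp(−p_{k+1} + (CM)²p⁻¹_{k+1}‖dA_k‖²_{□∼3})`"* (`S = ` the bonds of
`□∼3`). [cite: Dimock2022UVStabilityQED3, §4.2.2 Lemma 23 proof (479) p.65 L16–30] -/
theorem eq479 (S : Finset α) (dA : α → ℝ) {ζ p CM : ℝ} (hζ1 : ζ ≤ 1) (hp : 0 < p) (hCM : 0 < CM)
    (henf : ζ ≠ 0 → ∃ b ∈ S, CM⁻¹ * p ≤ |dA b|) :
    ζ ≤ Real.exp (-p + CM ^ 2 * p⁻¹ * ∑ b ∈ S, dA b ^ 2) := by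
  have h := zeta_le_exp S dA hζ1 hp.le (by positivity : 0 < CM⁻¹ * p) henf
  have hcoef : p / (CM⁻¹ * p) ^ 2 = CM ^ 2 * p⁻¹ := by
    field_simp
  rwa [hcoef] at h

/-- **(484)**: *"`ζ′_k(□)` enforces that there must be a bond in `□∼3` such that `|dA_k| ≥ (CM)⁻¹p²_{0,k}` … Therefore
`|ζ′_k(□)| ≤ exp(−p²_{0,k} + (CM)²p⁻²_{0,k}‖dA_k‖²_{□∼3})`"*.
[cite: Dimock2022UVStabilityQED3, §4.2.2 Lemma 23 proof (484) p.65 L98–114] -/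
theorem eq484 (S : Finset α) (dA : α → ℝ) {ζ p₀ CM : ℝ} (hζ1 : ζ ≤ 1) (hp : 0 < p₀) (hCM : 0 < CM)
    (henf : ζ ≠ 0 → ∃ b ∈ S, CM⁻¹ * p₀ ^ 2 ≤ |dA b|) :
    ζ ≤ Real.exp (-p₀ ^ 2 + CM ^ 2 * (p₀ ^ 2)⁻¹ * ∑ b ∈ S, dA b ^ 2) := by
  have h := zeta_le_exp S dA hζ1 (by positivity : (0:ℝ) ≤ p₀ ^ 2) (by positivity : 0 < CM⁻¹ * p₀ ^ 2) henf
  have hcoef : p₀ ^ 2 / (CM⁻¹ * p₀ ^ 2) ^ 2 = CM ^ 2 * (p₀ ^ 2)⁻¹ := by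
    field_simp
  rwa [hcoef] at h

/-- **(485)**: *"there must be a point in `□̃` where `|Z̃_k| ≥ C⁻¹p^{4∕3}_{0,k}`. Thus `ζ†(□) ≤ exp(−p^{4∕3}_{0,k} +
C²p^{−4∕3}_{0,k}‖Z̃_k‖²_{□̃})`"* (`S = ` the points of `□̃`).
[cite: Dimock2022UVStabilityQED3, §4.2.2 Lemma 23 proof (485) p.65 L116 – p.66 L18] -/
theorem eq485 (S : Finset α) (Z : α → ℝ) {ζ p₀ C : ℝ} (hζ1 : ζ ≤ 1) (hp : 0 < p₀) (hC : 0 < C)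
    (henf : ζ ≠ 0 → ∃ x ∈ S, C⁻¹ * p₀ ^ (4 / 3 : ℝ) ≤ |Z x|) :
    ζ ≤ Real.exp (-p₀ ^ (4 / 3 : ℝ) + C ^ 2 * p₀ ^ (-(4 / 3) : ℝ) * ∑ x ∈ S, Z x ^ 2) := by
  have h43 : 0 < p₀ ^ (4 / 3 : ℝ) := Real.rpow_pos_of_pos hp _
  have h := zeta_le_exp S Z hζ1 h43.le (by positivity : 0 < C⁻¹ * p₀ ^ (4 / 3 : ℝ)) henf
  have hcoef : p₀ ^ (4 / 3 : ℝ) / (C⁻¹ * p₀ ^ (4 / 3 : ℝ)) ^ 2 = C ^ 2 * p₀ ^ (-(4 / 3) : ℝ) := by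
    rw [Real.rpow_neg hp.le]
    field_simp
  rwa [hcoef] at h

/-- **(486)**: *"the characteristic function `ζ̂(□)` enforces there is at least one point in `□` where `|Z̃_k| ≥ p_{0,k}`.
and so `ζ̂(□) ≤ exp(−p_{0,k} + p⁻¹_{0,k}‖Z_k‖²_□)`"* (`S = ` the points of `□`).
[cite: Dimock2022UVStabilityQED3, §4.2.2 Lemma 23 proof (486) p.66 L23–31] -/
theorem eq486 (S : Finset α) (Z : α → ℝ) {ζ p₀ : ℝ} (hζ1 : ζ ≤ 1) (hp : 0 < p₀)
    (henf : ζ ≠ 0 → ∃ x ∈ S, p₀ ≤ |Z x|) :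
    ζ ≤ Real.exp (-p₀ + p₀⁻¹ * ∑ x ∈ S, Z x ^ 2) := by
  have h := zeta_le_exp S Z hζ1 hp.le hp henf
  have hcoef : p₀ / p₀ ^ 2 = p₀⁻¹ := by field_simp
  rwa [hcoef] at h

end Cube

/-! ## §3 «Now take the product over □ ⊂ P_{k+1}» -/

section Product

variable {α β : Type*}

/-- **The product over the cubes** (p.65 L31, L115, p.66 L19, L32): for a finite family `cs` of cubes with search sets
`S(□)` and characteristic functions `0 ≤ ζ(□) ≤ 1` each enforcing a bond of `S(□)` with `|f| ≥ q`,
`Π_{□∈cs}ζ(□) ≤ exp(−a·#cubes + (a∕q²)·Σ_{□∈cs}‖f‖²_{S(□)})`.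
[cite: Dimock2022UVStabilityQED3, §4.2.2 Lemma 23 proof p.65 L31–36 with (479) p.65 L16–30] -/
theorem prod_zeta_le_exp (cs : Finset β) (S : β → Finset α) (f : α → ℝ) (ζ : β → ℝ) {a q : ℝ}
    (hζ0 : ∀ B ∈ cs, 0 ≤ ζ B) (hζ1 : ∀ B ∈ cs, ζ B ≤ 1) (ha : 0 ≤ a) (hq : 0 < q)
    (henf : ∀ B ∈ cs, ζ B ≠ 0 → ∃ b ∈ S B, q ≤ |f b|) :
    ∏ B ∈ cs, ζ B ≤ Real.exp (-(a * cs.card) + a / q ^ 2 * ∑ B ∈ cs, ∑ b ∈ S B, f b ^ 2) := by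
  calc ∏ B ∈ cs, ζ B ≤ ∏ B ∈ cs, Real.exp (-a + a / q ^ 2 * ∑ b ∈ S B, f b ^ 2) :=
        Finset.prod_le_prod hζ0 fun B hB => zeta_le_exp (S B) f (hζ1 B hB) ha hq (henf B hB)
    _ = Real.exp (-(a * cs.card) + a / q ^ 2 * ∑ B ∈ cs, ∑ b ∈ S B, f b ^ 2) := by
        rw [← Real.exp_sum, Finset.sum_add_distrib, Finset.sum_const, nsmul_eq_mul, ← Finset.mul_sum]
        ring_nf

end Product

/-! ## §4 (480): the overlap count `Σ_{□⊂P_{k+1}}‖dA_k‖²_{□∼3} = O(1)‖dA_k‖²_{P∼3_{k+1}}`, and the number of cubes -/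

section Overlap

variable {α β : Type*}

/-- **Double counting behind (480)**: if every search set `S(□)` (`□ ∈ cs`) lies in `T` and every `b ∈ T` belongs to at
most `m` of them, then for `g ≥ 0` on `T`, `Σ_{□∈cs}Σ_{b∈S(□)}g(b) ≤ m·Σ_{b∈T}g(b)` — *"`Σ_{□⊂P_{k+1}}Σ_{□′⊂□∼3}‖dA_k‖²_{□′} =
O(1)Σ_{□′⊂P∼3_{k+1}}‖dA_k‖²_{□′}`"* (the same device as `SmallFactors.stepB_double_counting` of this directory, here with
bonds and cubes of different types). [cite: Dimock2022UVStabilityQED3, §4.2.2 Lemma 23 proof (480) p.65 L37–55] -/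
theorem sum_sum_le_mul_sum_of_overlap [DecidableEq α] (cs : Finset β) (S : β → Finset α) (T : Finset α)
    (g : α → ℝ) (hg : ∀ b ∈ T, 0 ≤ g b) (hS : ∀ B ∈ cs, S B ⊆ T) (m : ℕ)
    (hmult : ∀ b ∈ T, (cs.filter fun B => b ∈ S B).card ≤ m) :
    ∑ B ∈ cs, ∑ b ∈ S B, g b ≤ m * ∑ b ∈ T, g b := by
  have hswap : ∑ B ∈ cs, ∑ b ∈ S B, g b = ∑ b ∈ T, ((cs.filter fun B => b ∈ S B).card : ℝ) * g b := by
    have h1 : ∀ B ∈ cs, ∑ b ∈ S B, g b = ∑ b ∈ T, if b ∈ S B then g b else 0 := by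
      intro B hB
      rw [← Finset.sum_filter]
      congr 1
      ext b
      simp only [Finset.mem_filter]
      exact ⟨fun h => ⟨hS B hB h, h⟩, fun h => h.2⟩
    rw [Finset.sum_congr rfl h1, Finset.sum_comm]
    refine Finset.sum_congr rfl fun b _ => ?_
    rw [Finset.card_filter, Nat.cast_sum, Finset.sum_mul]
    refine Finset.sum_congr rfl fun B _ => ?_
    split_ifs <;> simp
  rw [hswap, Finset.mul_sum]
  exact Finset.sum_le_sum fun b hb => mul_le_mul_of_nonneg_right (by exact_mod_cast hmult b hb) (hg b hb)

/-- **(480)**: `Σ_{□⊂P_{k+1}}‖dA_k‖²_{□∼3} ≤ m·‖dA_k‖²_T` when every bond of `T ⊇ ⋃□∼3` lies in at most `m` of the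
enlarged cubes `□∼3` (the print's `O(1)`; `T = P∼3_{k+1}`).
[cite: Dimock2022UVStabilityQED3, §4.2.2 Lemma 23 proof (480) p.65 L37–55] -/
theorem eq480 [DecidableEq α] (cs : Finset β) (S : β → Finset α) (T : Finset α) (dA : α → ℝ)
    (hS : ∀ B ∈ cs, S B ⊆ T) (m : ℕ) (hmult : ∀ b ∈ T, (cs.filter fun B => b ∈ S B).card ≤ m) :
    ∑ B ∈ cs, ∑ b ∈ S B, dA b ^ 2 ≤ m * ∑ b ∈ T, dA b ^ 2 :=
  sum_sum_le_mul_sum_of_overlap cs S T (fun b => dA b ^ 2) (fun _ _ => sq_nonneg _) hS m hmult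

/-- Disjoint search sets (the `ζ̂` case, where `□` is searched in itself): every point lies in at most ONE of them.
[cite: Dimock2022UVStabilityQED3, §4.2.2 Lemma 23 proof p.66 L23–33] -/
theorem card_filter_mem_le_one [DecidableEq α] (cs : Finset β) (S : β → Finset α)
    (hdisj : (cs : Set β).PairwiseDisjoint S) (b : α) : (cs.filter fun B => b ∈ S B).card ≤ 1 := by
  rw [Finset.card_le_one]
  intro B hB B' hB'
  rw [Finset.mem_filter] at hB hB'
  by_contra hne
  have h := hdisj hB.1 hB'.1 hne
  exact (Finset.disjoint_left.mp h) hB.2 hB'.2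

/-- **The number of cubes, I**: for pairwise-disjoint cubes of `V` sites each, `#cubes · V = |⋃_□ □|` (*"The volume of
`P_{k+1}` is … Each cube has volume `(LMr_{k+1})³`"*). [cite: Dimock2022UVStabilityQED3, §4.2.2 Lemma 23 proof p.65 L31–36] -/
theorem card_cubes_mul_vol [DecidableEq α] (cs : Finset β) (S : β → Finset α)
    (hdisj : (cs : Set β).PairwiseDisjoint S) {V : ℕ} (hV : ∀ B ∈ cs, (S B).card = V) :
    cs.card * V = (cs.biUnion S).card := by
  rw [Finset.card_biUnion hdisj, Finset.sum_congr rfl hV, Finset.sum_const, smul_eq_mul]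

/-- **The number of cubes, II** (as printed): *"so the number of cubes in `P_{k+1}` is `(Mr_{k+1})⁻³|P^{(k+1)}_{k+1}|`"* —
`#cubes = V⁻¹·|⋃_□ □|` with `V = (Mr_{k+1})³` the volume of a cube in `L`-cube units.
[cite: Dimock2022UVStabilityQED3, §4.2.2 Lemma 23 proof p.65 L31–36] -/
theorem card_cubes_eq [DecidableEq α] (cs : Finset β) (S : β → Finset α)
    (hdisj : (cs : Set β).PairwiseDisjoint S) {V : ℕ} (hVpos : 0 < V) (hV : ∀ B ∈ cs, (S B).card = V) :
    (cs.card : ℝ) = (V : ℝ)⁻¹ * (cs.biUnion S).card := by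
  have h := card_cubes_mul_vol cs S hdisj hV
  have hV' : (V : ℝ) ≠ 0 := by exact_mod_cast hVpos.ne'
  rw [eq_inv_mul_iff_mul_eq₀ hV', mul_comm]
  exact_mod_cast h

end Overlap

/-! ## §5 LEMMA 23 (471) assembled -/

section Assembled

variable {α β : Type*}

/-- **LEMMA 23, common shape of the four lines of (471)**: cubes `cs` with search sets `S(□) ⊆ X` of overlap
multiplicity `≤ m`, characteristic functions `0 ≤ ζ(□) ≤ 1` each enforcing a bond of `S(□)` with `|f| ≥ q > 0`, rate
`a ≥ 0`: `Π_{□∈cs}ζ(□) ≤ exp(−a·#cubes + (a∕q²)·m·‖f‖²_X)` — (479) per cube, the product over the cubes, (480), and the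
region inclusion `⋃S(□) ⊆ X` (*"which we use in (480). Altogether the announced bound … results"*).
[cite: Dimock2022UVStabilityQED3, §4.2.2 Lemma 23 (471) p.64 L8–48, proof p.65 L6–72] -/
theorem lemma23_shape [DecidableEq α] (cs : Finset β) (S : β → Finset α) (X : Finset α) (f : α → ℝ)
    (ζ : β → ℝ) {a q : ℝ} (hζ0 : ∀ B ∈ cs, 0 ≤ ζ B) (hζ1 : ∀ B ∈ cs, ζ B ≤ 1) (ha : 0 ≤ a) (hq : 0 < q)
    (henf : ∀ B ∈ cs, ζ B ≠ 0 → ∃ b ∈ S B, q ≤ |f b|) (hS : ∀ B ∈ cs, S B ⊆ X) (m : ℕ)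
    (hmult : ∀ b ∈ X, (cs.filter fun B => b ∈ S B).card ≤ m) :
    ∏ B ∈ cs, ζ B ≤ Real.exp (-(a * cs.card) + a / q ^ 2 * m * ∑ b ∈ X, f b ^ 2) := by
  refine (prod_zeta_le_exp cs S f ζ hζ0 hζ1 ha hq henf).trans ?_
  rw [Real.exp_le_exp, mul_assoc]
  have hov := eq480 cs S X f hS m hmult
  have hcoef : 0 ≤ a / q ^ 2 := by positivity
  linarith [mul_le_mul_of_nonneg_left hov hcoef]

/-- **(471), line 1**: `ζ⁰_{k+1}(P_{k+1}) ≤ exp(−p_{k+1}·n + (CM)²m·p⁻¹_{k+1}‖dA_k‖²_X)` — `n = #cubes = (Mr_{k+1})⁻³|P^{(k+1)}_{k+1}|`,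
`X = ` the bonds of `[Λ_k − Ω_{k+1}]^{2♮} ⊇ P∼3_{k+1}`, threshold `(CM)⁻¹p_{k+1}` on `□∼3`; the print's `CM²p⁻¹_{k+1}` has
`C ← C²m`. [cite: Dimock2022UVStabilityQED3, §4.2.2 Lemma 23 (471) line 1 p.64 L8–18, proof p.65 L6–72] -/
theorem zeta0_bound [DecidableEq α] (cs : Finset β) (S : β → Finset α) (X : Finset α) (dA : α → ℝ)
    (ζ : β → ℝ) {p CM n : ℝ} (hζ0 : ∀ B ∈ cs, 0 ≤ ζ B) (hζ1 : ∀ B ∈ cs, ζ B ≤ 1) (hp : 0 < p) (hCM : 0 < CM)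
    (henf : ∀ B ∈ cs, ζ B ≠ 0 → ∃ b ∈ S B, CM⁻¹ * p ≤ |dA b|) (hS : ∀ B ∈ cs, S B ⊆ X) (m : ℕ)
    (hmult : ∀ b ∈ X, (cs.filter fun B => b ∈ S B).card ≤ m) (hn : (cs.card : ℝ) = n) :
    ∏ B ∈ cs, ζ B ≤ Real.exp (-(p * n) + CM ^ 2 * m * p⁻¹ * ∑ b ∈ X, dA b ^ 2) := by
  have h := lemma23_shape cs S X dA ζ hζ0 hζ1 hp.le (by positivity : 0 < CM⁻¹ * p) henf hS m hmult
  have hcoef : p / (CM⁻¹ * p) ^ 2 * m = CM ^ 2 * m * p⁻¹ := by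
    field_simp
  rwa [hcoef, hn] at h

/-- **(471), line 2**: `ζ′_k(Q_{k+1}) ≤ exp(−p²_{0,k}·n + (CM)²m·p⁻²_{0,k}‖dA_k‖²_X)` (threshold `(CM)⁻¹p²_{0,k}` on `□∼3`, (484);
*"Take the product over `□ ⊂ Q_{k+1}` to get the result as before"*).
[cite: Dimock2022UVStabilityQED3, §4.2.2 Lemma 23 (471) line 2 p.64 L19–28, proof (481)–(484) p.65 L73–115] -/
theorem zetaPrime_bound [DecidableEq α] (cs : Finset β) (S : β → Finset α) (X : Finset α) (dA : α → ℝ)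
    (ζ : β → ℝ) {p₀ CM n : ℝ} (hζ0 : ∀ B ∈ cs, 0 ≤ ζ B) (hζ1 : ∀ B ∈ cs, ζ B ≤ 1) (hp : 0 < p₀) (hCM : 0 < CM)
    (henf : ∀ B ∈ cs, ζ B ≠ 0 → ∃ b ∈ S B, CM⁻¹ * p₀ ^ 2 ≤ |dA b|) (hS : ∀ B ∈ cs, S B ⊆ X) (m : ℕ)
    (hmult : ∀ b ∈ X, (cs.filter fun B => b ∈ S B).card ≤ m) (hn : (cs.card : ℝ) = n) :
    ∏ B ∈ cs, ζ B ≤ Real.exp (-(p₀ ^ 2 * n) + CM ^ 2 * m * (p₀ ^ 2)⁻¹ * ∑ b ∈ X, dA b ^ 2) := by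
  have h := lemma23_shape cs S X dA ζ hζ0 hζ1 (by positivity : (0 : ℝ) ≤ p₀ ^ 2)
    (by positivity : 0 < CM⁻¹ * p₀ ^ 2) henf hS m hmult
  have hcoef : p₀ ^ 2 / (CM⁻¹ * p₀ ^ 2) ^ 2 * m = CM ^ 2 * m * (p₀ ^ 2)⁻¹ := by
    field_simp
  rwa [hcoef, hn] at h

/-- **(471), line 3**: `ζ†_k(R_{k+1}) ≤ exp(−p^{4∕3}_{0,k}·n + C²m·p^{−4∕3}_{0,k}‖Z̃_k‖²_X)` (threshold `C⁻¹p^{4∕3}_{0,k}` on `□̃`,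
(485); `X = ` the points of `[Ω_{k+1} − Λ_{k+1}]^♮ ⊇ R̃_{k+1}`).
[cite: Dimock2022UVStabilityQED3, §4.2.2 Lemma 23 (471) line 3 p.64 L29–39, proof (485) p.65 L116 – p.66 L22] -/
theorem zetaDagger_bound [DecidableEq α] (cs : Finset β) (S : β → Finset α) (X : Finset α) (Z : α → ℝ)
    (ζ : β → ℝ) {p₀ C n : ℝ} (hζ0 : ∀ B ∈ cs, 0 ≤ ζ B) (hζ1 : ∀ B ∈ cs, ζ B ≤ 1) (hp : 0 < p₀) (hC : 0 < C)
    (henf : ∀ B ∈ cs, ζ B ≠ 0 → ∃ x ∈ S B, C⁻¹ * p₀ ^ (4 / 3 : ℝ) ≤ |Z x|) (hS : ∀ B ∈ cs, S B ⊆ X) (m : ℕ)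
    (hmult : ∀ x ∈ X, (cs.filter fun B => x ∈ S B).card ≤ m) (hn : (cs.card : ℝ) = n) :
    ∏ B ∈ cs, ζ B
      ≤ Real.exp (-(p₀ ^ (4 / 3 : ℝ) * n) + C ^ 2 * m * p₀ ^ (-(4 / 3) : ℝ) * ∑ x ∈ X, Z x ^ 2) := by
  have h43 : 0 < p₀ ^ (4 / 3 : ℝ) := Real.rpow_pos_of_pos hp _
  have h := lemma23_shape cs S X Z ζ hζ0 hζ1 h43.le (by positivity : 0 < C⁻¹ * p₀ ^ (4 / 3 : ℝ)) henf hS m hmult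
  have hcoef : p₀ ^ (4 / 3 : ℝ) / (C⁻¹ * p₀ ^ (4 / 3 : ℝ)) ^ 2 * m = C ^ 2 * m * p₀ ^ (-(4 / 3) : ℝ) := by
    rw [Real.rpow_neg hp.le]
    field_simp
  rwa [hcoef, hn] at h

/-- **(471), line 4**: `ζ̂_k(U_{k+1}) ≤ exp(−p_{0,k}·n + p⁻¹_{0,k}‖Z_k‖²_X)` — the cubes are searched in themselves and are
pairwise disjoint, so the multiplicity is `1` (threshold `p_{0,k}`, (486); *"Again take the product over `□ ⊂ U_{k+1}`. Since
`U_k ⊂ Ω_{k+1} − Λ_{k+1}` we have. the result"*).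
[cite: Dimock2022UVStabilityQED3, §4.2.2 Lemma 23 (471) line 4 p.64 L40–48, proof (486) p.66 L23–33] -/
theorem zetaHat_bound [DecidableEq α] (cs : Finset β) (S : β → Finset α) (X : Finset α) (Z : α → ℝ)
    (ζ : β → ℝ) {p₀ n : ℝ} (hζ0 : ∀ B ∈ cs, 0 ≤ ζ B) (hζ1 : ∀ B ∈ cs, ζ B ≤ 1) (hp : 0 < p₀)
    (henf : ∀ B ∈ cs, ζ B ≠ 0 → ∃ x ∈ S B, p₀ ≤ |Z x|) (hS : ∀ B ∈ cs, S B ⊆ X)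
    (hdisj : (cs : Set β).PairwiseDisjoint S) (hn : (cs.card : ℝ) = n) :
    ∏ B ∈ cs, ζ B ≤ Real.exp (-(p₀ * n) + p₀⁻¹ * ∑ x ∈ X, Z x ^ 2) := by
  have h := lemma23_shape cs S X Z ζ hζ0 hζ1 hp.le hp henf hS 1 fun x _ => card_filter_mem_le_one cs S hdisj x
  have hcoef : p₀ / p₀ ^ 2 * ((1 : ℕ) : ℝ) = p₀⁻¹ := by
    rw [Nat.cast_one, mul_one]
    field_simp
  rwa [hcoef, hn] at h

end Assembled

/-! ## §6 After (490): «In the decay factors take the minimum coefficient which is p_{0,j}» -/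

section Collect

/-- **The minimum decay coefficient** (p.66 L126 – p.67 L1, the step from (489)–(490) to (491)): with `1 ≤ p_{0,j} ≤ p_{j+1}`
the four rates of (471) are all `≥ p_{0,j}` — `p_{j+1}`, `p²_{0,j}`, `p^{4∕3}_{0,j}`, `p_{0,j}` — so for non-negative cube counts (`n_U` arbitrary)
`−p_{j+1}n_P − p²_{0,j}n_Q − p^{4∕3}_{0,j}n_R − p_{0,j}n_U ≤ −p_{0,j}(n_P + n_Q + n_R + n_U)`.
[cite: Dimock2022UVStabilityQED3, §4.2.2 (489)–(491) p.66 L90 – p.67 L27] -/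
theorem decay_min_coefficient {p₀ p₁ nP nQ nR : ℝ} (nU : ℝ) (hp₀ : 1 ≤ p₀) (hp₁ : p₀ ≤ p₁) (hP : 0 ≤ nP)
    (hQ : 0 ≤ nQ) (hR : 0 ≤ nR) :
    -(p₁ * nP) - p₀ ^ 2 * nQ - p₀ ^ (4 / 3 : ℝ) * nR - p₀ * nU ≤ -(p₀ * (nP + nQ + nR + nU)) := by
  have h2 : p₀ ≤ p₀ ^ 2 := by nlinarith
  have h43 : p₀ ≤ p₀ ^ (4 / 3 : ℝ) := by
    calc p₀ = p₀ ^ (1 : ℝ) := (Real.rpow_one p₀).symm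
      _ ≤ p₀ ^ (4 / 3 : ℝ) := Real.rpow_le_rpow_of_exponent_le hp₀ (by norm_num)
  nlinarith [mul_le_mul_of_nonneg_right hp₁ hP, mul_le_mul_of_nonneg_right h2 hQ,
    mul_le_mul_of_nonneg_right h43 hR]

/-- **One level of (489) ⟹ (491)**: the product of the four bounds of (471) at level `j` is at most
`exp(−p_{0,j}(n_P + n_Q + n_R + n_U) + (f_P + f_Q + f_R + f_U))`, the `f`'s being the four field terms (kept; they are
the exponent of (492)). [cite: Dimock2022UVStabilityQED3, §4.2.2 (489)–(492) p.66 L90 – p.67 L48] -/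
theorem eq489_level {p₀ p₁ nP nQ nR : ℝ} (nU fP fQ fR fU : ℝ) (hp₀ : 1 ≤ p₀) (hp₁ : p₀ ≤ p₁) (hP : 0 ≤ nP)
    (hQ : 0 ≤ nQ) (hR : 0 ≤ nR) :
    Real.exp (-(p₁ * nP) + fP) * Real.exp (-(p₀ ^ 2 * nQ) + fQ) * Real.exp (-(p₀ ^ (4 / 3 : ℝ) * nR) + fR)
        * Real.exp (-(p₀ * nU) + fU)
      ≤ Real.exp (-(p₀ * (nP + nQ + nR + nU)) + (fP + fQ + fR + fU)) := by
  rw [← Real.exp_add, ← Real.exp_add, ← Real.exp_add, Real.exp_le_exp]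
  linarith [decay_min_coefficient nU hp₀ hp₁ hP hQ hR]

end Collect

/-! ## §7 Instances (non-vacuity) -/

section Instances

/-- one cube `{0,1} ⊂ ℕ` carrying the field `dA ≡ 3`, threshold `q = 2 ≤ 3`, rate `a = 4`: a characteristic function
`ζ = 1` obeys (479)'s shape `1 ≤ exp(−4 + (4∕2²)(3² + 3²)) = e^{14}`. -/
example : (1 : ℝ) ≤ Real.exp (-4 + 4 / 2 ^ 2 * ∑ b ∈ ({0, 1} : Finset ℕ), (fun _ => (3 : ℝ)) b ^ 2) :=
  zeta_le_exp {0, 1} (fun _ => (3 : ℝ)) le_rfl (by norm_num) two_pos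
    fun _ => ⟨0, by simp, by norm_num⟩

/-- a vanishing characteristic function is bounded by anything of the form `exp(…)` (the *"trivial"* case of (479)). -/
example : (0 : ℝ) ≤ Real.exp (-4 + 4 / 2 ^ 2 * ∑ b ∈ (∅ : Finset ℕ), (fun _ => (0 : ℝ)) b ^ 2) :=
  zeta_le_exp ∅ (fun _ => (0 : ℝ)) zero_le_one (by norm_num) two_pos fun h => absurd rfl h

end Instances

end QED3LargeFieldCharacteristic

end Literature.MathematicalPhysics.QuantumFieldTheory.Dimock2011to13

end
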